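import Summits.BirchSwinnertonDyer.Rank1Residual.P2.CongruentNumberSilentEvenFiveEnclosure
import Summits.BirchSwinnertonDyer.Rank1Residual.P2.CongruentNumberSilentEvenFiveSelmerEight
import Literature.NumberTheory.EllipticCurves.Tian2014.CMPointSystemGenusBridge
import HarnessLib

/-!
# Cell «bsd-monsky» (typer): THE ENCLOSURE WITHOUT Cor 5.15 — C-P2-1 relative to Heath-Brown 1994's Selmer count
# (`monsky_card_selmerGroup_two_even`, Monsky's even matrix — Heath-Brown 1994, Appendix (Monsky), even case, printed as
# a sketch proof (journal pp. 368–369); a NAMED FACT of the tree, not a theorem) and the ONE system fact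
# `tian2014_system_sMinus_genus` (Tian Thm. 2.8 system ∧ the (B4)-flagged Gross–Zagier index relation ∧ Gauss genus theory)

HONEST FRAMING: nothing asserted; conditional on the displayed fact `hSys` and on `hMe` (Heath-Brown 1994, appendix by
Monsky — the binder every `s(n)` door of the sub-lane carries). Rank one on `𝒮⁻` is a KERNEL theorem here (prover-A's
`P2/CongruentNumberSilentEvenFiveSelmerEight.lean`: `#Sel₂ = 8` from the even matrix by `decide`, and the system's
non-halvable point forces rank `≥ 1`), so Monsky's Cor 5.15 is not used (its Remark (2), p. 67, reads: «The very patient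
reader may verify that S̄ = Z/2 and S̄* = (0) precisely when we are in one of the 16 cases listed in Theorems 5.13 and 5.14.»).
The conjecture `Prop`s stay `@[conjecture]` until `hSys` is a Literature fact of the tree.
References: HOME `lean/PLAN.md` v0.6, `Enclosure_genus_check.lean`, prover-A's STATUS line 15:32Z.
-/

noncomputable section

open scoped Classical

open WeierstrassCurve Literature.NumberTheory.EllipticCurves
  Literature.NumberTheory.EllipticCurves.Rank1Residual
  Literature.NumberTheory.EllipticCurves.Rank1Residual.Typed
  Literature.NumberTheory.EllipticCurves.TianYuanZhang2017

set_option autoImplicit false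

/-! ## (typer) The h515-FREE enclosure: rank one from `#Sel₂ = 8` (Heath-Brown 1994 appendix) and M-y -/

namespace Summit.BirchSwinnertonDyer.Rank1Residual.P2

open Conjectures Literature.NumberTheory.EllipticCurves.Tian2014
  Literature.NumberTheory.EllipticCurves.HeathBrown1994

/-- **Rank one on `𝒮⁻` from the system fact and Monsky's even matrix** (no Cor 5.15): the system's M-y point is not
in `2E(ℚ) + tor`, so the rank is `≥ 1`; `#Sel₂ = 8` bounds it by `1` (`hMe`: the even case of the appendix, printed as a
sketch proof, journal pp. 368–369). [cite: HeathBrown1994SelmerCongruentII, Appendix (Monsky)]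
[cite: Monsky1990MockHeegner, Lemma 3.3 (3) and the Remark (p. 53)] -/
theorem mordellWeilRank_eq_one_of_genusSystem (hMe : monsky_card_selmerGroup_two_even)
    (hSys : tian2014_system_sMinus_genus) :
    ∀ p q : ℕ, p.Prime → q.Prime → p % 8 = 5 → q % 4 = 3 → jacobiSym p q = -1 →
      (congruentNumberCurve (2 * (p * q))).mordellWeilRank = 1 := by
  intro p q hp hq hp5 hq4 hj
  obtain ⟨hN, -, -, -⟩ := isCor515Family_two_mul_five_mul hp hq hp5 hq4
  obtain ⟨D, hP, -, hG⟩ := hSys p q hp hq hp5 hq4 hj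
  have hM := D.monskyDisplays_of_genusTheoryDisplays hP hp hq hp5 hq4 hj hG
  obtain ⟨-, -, y', -, hnot⟩ :=
    D.minusY_of_monskyDisplays (Nat.mul_ne_zero hp.ne_zero hq.ne_zero) hN.squarefree hP hM
  exact mordellWeilRank_eq_one_of_card_selmerGroup_two_eq_eight hN.ne_zero
    (card_selmerGroup_two_two_mul_five_mul hMe hp hq hp5 hq4 hj) y' hnot

/-- **C-P2-1 (sharper form) from the system fact and Monsky's even matrix, no Cor 5.15.**
[cite: TianYuanZhang2017, §1 (definition of 𝓛(n) and (1.1))] [cite: HeathBrown1994SelmerCongruentII, Appendix (Monsky)] -/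
theorem congruentSilentEvenFiveOrdTwo_of_genusSystem_of_monskyEven (hMe : monsky_card_selmerGroup_two_even)
    (hSys : tian2014_system_sMinus_genus) : CongruentSilentEvenFiveOrdTwo := by
  intro p q hp hq hp5 hq4 hj
  obtain ⟨hN, hp2, hq2, hne⟩ := isCor515Family_two_mul_five_mul hp hq hp5 hq4
  have hsq : Squarefree (2 * (p * q)) := hN.squarefree
  haveI := isElliptic_congruentNumberCurve hN.ne_zero
  have hrank := mordellWeilRank_eq_one_of_genusSystem hMe hSys p q hp hq hp5 hq4 hj
  obtain ⟨g, hg, -⟩ := exists_generatesFreePartRat_of_mordellWeilRank_eq_one hN.ne_zero hrank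
  obtain ⟨D, hP, hGZ, hG⟩ := hSys p q hp hq hp5 hq4 hj
  have hM := D.monskyDisplays_of_genusTheoryDisplays hP hp hq hp5 hq4 hj hG
  have hMY := D.minusY_of_monskyDisplays (Nat.mul_ne_zero hp.ne_zero hq.ne_zero) hsq hP hM
  obtain ⟨L, hLodd, hL⟩ := D.exists_odd_scriptL_of_minusY_of_grossZagier _ hGZ hMY g hg
  have hL0' : L ≠ 0 := fun h => by simp [h] at hLodd
  have hL0 : (L : ℚ) ≠ 0 := by exact_mod_cast hL0'
  have hr1 := analyticRank_congruentNumberCurve_eq_one_of_isScriptL hsq hN.mod_eight hL hL0'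
  obtain ⟨he, -⟩ := twoExponent_tamagawa_two_mul_prime_mul hp hq hp2 hq2 hne
  refine ⟨(2 : ℚ) ^ twoExponent (2 * (p * q)) * (L : ℚ) ^ 2,
    mul_ne_zero (zpow_ne_zero _ two_ne_zero) (pow_ne_zero _ hL0), ?_, ?_⟩
  · rw [← (leadingLCoeff_eq_deriv_of_analyticRank_eq_one hr1).1,
      leadingLCoeff_congruentNumberCurve_eq_of_isScriptL (Nat.pos_of_ne_zero hN.ne_zero) hr1 hL]
    push_cast
    ring
  · rw [padicValRat_two_zpow_mul_sq hLodd, he]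

/-- **THE ENCLOSURE WITHOUT COR 5.15: C-P2-1 relative to Heath-Brown 1994's Selmer count (`hMe` — Heath-Brown 1994,
Appendix (Monsky), even case, printed as a sketch proof, journal pp. 368–369; a named fact of the tree) and the ONE system
fact** (genus form). Sorry-free; nothing asserted.
[cite: HeathBrown1994SelmerCongruentII, Appendix (Monsky)] [cite: Tian2014, Thm. 2.8 (J132), Notations (J122–123)]
[cite: TianYuanZhang2017, Thm. 3.3] [cite: Miller2011LMS, Def. 1.1] -/
theorem congruentSilentEvenFiveBSDTwo_of_genusSystem_of_monskyEven (hMe : monsky_card_selmerGroup_two_even)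
    (hSys : tian2014_system_sMinus_genus) : CongruentSilentEvenFiveBSDTwo :=
  congruentSilentEvenFiveBSDTwo_of_ordTwo_of_monskyEven hMe (mordellWeilRank_eq_one_of_genusSystem hMe hSys)
    (congruentSilentEvenFiveOrdTwo_of_genusSystem_of_monskyEven hMe hSys)

end Summit.BirchSwinnertonDyer.Rank1Residual.P2

end
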